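import Literature.Algebra.Homology.ExactCoupleEuler
import HarnessLib

/-!
# Sub-quotients `ker/im` along ladders of isomorphisms and for powers

Topic `Literature/Algebra/Homology`, a small supplement to `ExactCoupleEuler.lean` (whose
`SubQuot Z B = Z/(B ∩ Z)` is the page model of the homology exact couple, E. H. Spanier,
*Algebraic Topology* (1981), Ch. 9, Sec. 1). Elementary linear algebra over a division ring `K`, all
PROVED, used to identify the `E²` term of the spectral sequence of a fibre bundle
(`Literature/AlgebraicTopology/Homotopy/E2Ident.lean`, Spanier Ch. 9, Sec. 2, Thm. 16: the
isomorphism `ψ_* : E¹ ≅ C_*(B) ⊗ H_n(F)` is a chain map, hence induces `E² ≅ H_*(B) ⊗ H_n(F)`):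

* `subQuotEquivOfEquiv`: an isomorphism `e : V ≃ W` matching `Z ↔ Z'` and `B ↔ B'` induces
  `Z/(B ∩ Z) ≃ Z'/(B' ∩ Z')`; `subQuotKerRangeEquiv`: a ladder of isomorphisms between two
  composable pairs `V₂ → V₁ → V₀`, `W₂ → W₁ → W₀` identifies `ker/im` ("isomorphic complexes have
  isomorphic homology", the three-term case); `subQuotTopRangeEquiv` (no outgoing map).
* `piSub ι Z = Zᶥ ⊆ Vᶥ` (`Submodule.pi univ`), `subQuotPiEquiv : Zᶥ/(Bᶥ ∩ Zᶥ) ≃ (Z/(B ∩ Z))ᶥ`,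
  the componentwise map `piMap ι f` (an `abbrev` for Mathlib's `LinearMap.compLeft`) with
  `ker_piMap`, `range_piMap` (restating `LinearMap.ker_compLeft` / `range_compLeft`: homology of
  a finite power of a complex is the power of the homology), and `finrank_pi_eq_card_mul`.

No topology, no named facts, no `sorry`. [folklore] throughout.

## References

* E. H. Spanier, *Algebraic Topology*, Springer (1981), Ch. 9, Sec. 1 (pages of an exact couple),
  Sec. 2, Thm. 16. [Spanier1981]
-/

noncomputable section

open Module

namespace Literature.Algebra.Homology

universe u v w

variable {K : Type u} [DivisionRing K]

section Ladder

variable {V₀ V₁ V₂ : Type v} [AddCommGroup V₀] [Module K V₀] [AddCommGroup V₁] [Module K V₁] [AddCommGroup V₂] [Module K V₂]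
variable {W₀ W₁ W₂ : Type w} [AddCommGroup W₀] [Module K W₀] [AddCommGroup W₁] [Module K W₁] [AddCommGroup W₂] [Module K W₂]

/-- **Sub-quotients along an isomorphism**: if `e : V ≃ W` carries `Z` onto `Z'` (membership-wise)
and `B` onto `B'`, then `Z/(B ∩ Z) ≃ Z'/(B' ∩ Z')`. [folklore] -/
def subQuotEquivOfEquiv {V : Type v} [AddCommGroup V] [Module K V] {W : Type w} [AddCommGroup W] [Module K W]
    (e : V ≃ₗ[K] W) (Z B : Submodule K V) (Z' B' : Submodule K W)
    (hZ : ∀ v, v ∈ Z ↔ e v ∈ Z') (hB : ∀ v, v ∈ B ↔ e v ∈ B') : SubQuot Z B ≃ₗ[K] SubQuot Z' B' := by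
  refine subQuotEquivOfSurjective
    (toSubQuot Z.subtype Z B fun z => z.2) (toSubQuot (e.toLinearMap ∘ₗ Z.subtype) Z' B' fun z => (hZ z.1).1 z.2)
    (toSubQuot_surjective _ _ _ _ fun z hz => ⟨⟨z, hz⟩, rfl⟩)
    (toSubQuot_surjective _ _ _ _ fun w hw => ⟨⟨e.symm w, (hZ _).2 (by rw [LinearEquiv.apply_symm_apply]; exact hw)⟩, by
      simp⟩) ?_
  ext z
  rw [LinearMap.mem_ker, LinearMap.mem_ker, toSubQuot_apply_eq_zero_iff, toSubQuot_apply_eq_zero_iff]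
  exact hB z.1

/-- **`ker/im` along a ladder of isomorphisms**: vertical isomorphisms `e₁ : V₁ ≃ W₁`, `e₀`, `e₂`
commuting with `V₂ → V₁ → V₀` and `W₂ → W₁ → W₀` identify `ker d₀ / im d₁` with `ker d₀' / im d₁'`. [folklore] -/
def subQuotKerRangeEquiv (d₀ : V₁ →ₗ[K] V₀) (d₁ : V₂ →ₗ[K] V₁) (d₀' : W₁ →ₗ[K] W₀) (d₁' : W₂ →ₗ[K] W₁)
    (e₀ : V₀ ≃ₗ[K] W₀) (e₁ : V₁ ≃ₗ[K] W₁) (e₂ : V₂ ≃ₗ[K] W₂)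
    (h₀ : ∀ v, e₀ (d₀ v) = d₀' (e₁ v)) (h₁ : ∀ v, e₁ (d₁ v) = d₁' (e₂ v)) :
    SubQuot (LinearMap.ker d₀) (LinearMap.range d₁) ≃ₗ[K] SubQuot (LinearMap.ker d₀') (LinearMap.range d₁') :=
  subQuotEquivOfEquiv e₁ _ _ _ _
    (fun v => by rw [LinearMap.mem_ker, LinearMap.mem_ker, ← h₀, map_eq_zero_iff _ e₀.injective])
    (fun v => by
      constructor
      · rintro ⟨w, rfl⟩; exact ⟨e₂ w, (h₁ w).symm⟩
      · rintro ⟨w, hw⟩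
        refine ⟨e₂.symm w, e₁.injective ?_⟩
        rw [h₁, LinearEquiv.apply_symm_apply, hw])

/-- The same with no outgoing differential (`Z = ⊤`). [folklore] -/
def subQuotTopRangeEquiv (d₁ : V₂ →ₗ[K] V₁) (d₁' : W₂ →ₗ[K] W₁) (e₁ : V₁ ≃ₗ[K] W₁) (e₂ : V₂ ≃ₗ[K] W₂)
    (h₁ : ∀ v, e₁ (d₁ v) = d₁' (e₂ v)) :
    SubQuot (⊤ : Submodule K V₁) (LinearMap.range d₁) ≃ₗ[K] SubQuot (⊤ : Submodule K W₁) (LinearMap.range d₁') :=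
  subQuotEquivOfEquiv e₁ _ _ _ _ (fun _ => by simp)
    (fun v => by
      constructor
      · rintro ⟨w, rfl⟩; exact ⟨e₂ w, (h₁ w).symm⟩
      · rintro ⟨w, hw⟩
        refine ⟨e₂.symm w, e₁.injective ?_⟩
        rw [h₁, LinearEquiv.apply_symm_apply, hw])

end Ladder

section Pi

variable {ι : Type} [Fintype ι] [DecidableEq ι] {V : Type v} [AddCommGroup V] [Module K V]

/-- The componentwise submodule `{y | ∀ i, y i ∈ Z}` (Mathlib's `Submodule.pi univ`). [folklore] -/
abbrev piSub (ι : Type) (Z : Submodule K V) : Submodule K (ι → V) := Submodule.pi Set.univ fun _ => Z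

omit [Fintype ι] [DecidableEq ι] in
/-- Membership in `piSub`: every component lies in `Z`. [folklore] -/
theorem mem_piSub {Z : Submodule K V} {y : ι → V} : y ∈ piSub ι Z ↔ ∀ i, y i ∈ Z := by
  simp [piSub, Submodule.mem_pi]

/-- **`(Zᶥ)/(Bᶥ ∩ Zᶥ) ≃ (Z/(B ∩ Z))ᶥ`.** [folklore] -/
def subQuotPiEquiv (Z B : Submodule K V) : SubQuot (piSub ι Z) (piSub ι B) ≃ₗ[K] (ι → SubQuot Z B) := by
  let g : ↥(piSub ι Z) →ₗ[K] (ι → SubQuot Z B) :=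
    LinearMap.pi fun i => (B.comap Z.subtype).mkQ ∘ₗ
      (LinearMap.codRestrict Z (LinearMap.proj i ∘ₗ (piSub ι Z).subtype) fun y => (mem_piSub.1 y.2) i)
  have hg : Function.Surjective g := by
    intro y
    refine ⟨⟨fun i => ((y i).out : Z), mem_piSub.2 fun i => (Quotient.out (y i)).2⟩, funext fun i => ?_⟩
    simp only [g, LinearMap.pi_apply, LinearMap.comp_apply, Submodule.mkQ_apply]
    have : (LinearMap.codRestrict Z (LinearMap.proj i ∘ₗ (piSub ι Z).subtype) (fun y => (mem_piSub.1 y.2) i))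
        ⟨fun i => ((y i).out : Z), mem_piSub.2 fun i => (Quotient.out (y i)).2⟩ = (y i).out := rfl
    rw [this]
    exact Quotient.out_eq (y i)
  have hker : LinearMap.ker g = (piSub ι B).comap (piSub ι Z).subtype := by
    ext y
    simp only [g, LinearMap.mem_ker, Submodule.mem_comap, Submodule.subtype_apply, mem_piSub, funext_iff, LinearMap.pi_apply,
      LinearMap.comp_apply, Submodule.mkQ_apply, Pi.zero_apply, Submodule.Quotient.mk_eq_zero, Submodule.mem_comap]
    rfl
  exact (Submodule.quotEquivOfEq _ _ hker.symm) ≪≫ₗ LinearMap.quotKerEquivOfSurjective g hg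

/-- The componentwise map (Mathlib's `LinearMap.compLeft`, under the name used by
`E2Ident.lean`). [folklore] -/
abbrev piMap {W : Type w} [AddCommGroup W] [Module K W] (ι : Type) (f : V →ₗ[K] W) : (ι → V) →ₗ[K] (ι → W) :=
  f.compLeft ι

omit [Fintype ι] [DecidableEq ι] in
/-- The kernel of a componentwise map is the power of the kernel (`LinearMap.ker_compLeft`).
[folklore] -/
theorem ker_piMap {W : Type w} [AddCommGroup W] [Module K W] (f : V →ₗ[K] W) :
    LinearMap.ker (piMap ι f) = piSub ι (LinearMap.ker f) :=
  LinearMap.ker_compLeft f ι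

omit [Fintype ι] [DecidableEq ι] in
/-- The range of a componentwise map is the power of the range (`LinearMap.range_compLeft`).
[folklore] -/
theorem range_piMap {U : Type w} [AddCommGroup U] [Module K U] (f : U →ₗ[K] V) :
    LinearMap.range (piMap ι f) = piSub ι (LinearMap.range f) :=
  LinearMap.range_compLeft f ι

omit [DecidableEq ι] in
/-- `dim (ι → W) = #ι · dim W` for a finite-dimensional `W`. [folklore] -/
theorem finrank_pi_eq_card_mul {W : Type w} [AddCommGroup W] [Module K W] [Module.Finite K W] :
    finrank K (ι → W) = Fintype.card ι * finrank K W := by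
  rw [Module.finrank_pi_fintype, Finset.sum_const, Finset.card_univ, smul_eq_mul]

end Pi

end Literature.Algebra.Homology
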